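import Summits.ResolutionOfSingularities.ResolutionOfSingularities.Theorems.EquisingularLiftEquisingularLiftNatFirstOrderStrictTransform
import Mathlib.RingTheory.MvPolynomial.EulerIdentity
import HarnessLib

/-!
# [OURS] FIRST-ORDER ⟺ ONE-STEP: T-ONESTEP's Jacobian hypothesis on the strict transforms holds EXACTLY at the first-order points (`K = K̄`)
# (cruxes `Theses.EquisingularLift.EquisingularLiftNat` / `…NatThree` / `EquisingularLift`, stmt-ResolutionOfSingularities-20038 / -20148 / -15660)

[OURS · leafhand-res-equisingularlift-9 g0, 2026-08-31; cell `pub/decomp-res`] AI-produced, weaker than expert review; NOT a statement of any manuscript;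
nothing here proves resolution of singularities.  DEF-FREE helper; no `sorry`; standard axioms; ZERO named hypotheses.

✓ `FirstOrderPoint.exists_strictTransform(_of_forall_aeval)` (…NatFirstOrderStrictTransform) shows (FO) ⇒ (hone).  This file proves the CONVERSE over an
algebraically closed field, so that the reach of the one-point-blow-up method (seat res-D-pv-013's T-ONESTEP / T-MULTIORD and everything built on them) is
EXACTLY the class of first-order points — which makes the census line «the remaining isolated points (A_{≥3}, D, E, …) need TOWERS of blow-ups» a theorem
about the method rather than a remark:

* `FirstOrderPoint.aeval_update_zero_aeval_update_one` — evaluating `q(ŷ)` (`ŷ = (y with y_l := 1)`) at `t = (b with b_l := 0)` gives `q(b)` when `b_l = 1`;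
* `FirstOrderPoint.strictTransform_unique` — the strict transform `G_l` is determined by the identity `f(T_l, T_lT_j) = T_l^μ·G_l` (cancel `T_l^μ`);
* ★ `FirstOrderPoint.forall_aeval_of_oneStep` — **(hone) ⇒ (FO)** (`K = K̄`): a common non-zero zero `b` of `Φ, ∇Φ, Ψ₁`, scaled to `b_l = 1`, gives
  the point `t = (b with b_l := 0)` of the exceptional divisor of chart `l` at which `G_l` and ALL its partials vanish
  (`∂_jG_l(t) = ∂_jΦ(b)`, `j ≠ l`; `∂_lG_l(t) = Ψ₁(b)`);
* ★ `FirstOrderPoint.firstOrder_iff_oneStep` — the equivalence.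

References: [Hartshorne1977, I Thm. 5.1, II Ex. 7.12]; Euler / homogeneity of partials (Mathlib `IsHomogeneous.pderiv`).
-/

set_option linter.dupNamespace false -- mandated namespace `Summit.<Summit>.<Problem>` of this single-conjunct summit

noncomputable section

open MvPolynomial

namespace Summit.ResolutionOfSingularities.ResolutionOfSingularities.Cruxes.EquisingularLiftNat.Sections

namespace FirstOrderPoint

variable (K : Type) [Field K] {n : ℕ}

/-- **`q(ŷ)` evaluated at `t = (b with b_l := 0)` is `q(b)` when `b_l = 1`.** [folklore] -/
theorem aeval_update_zero_aeval_update_one (l : Fin n) (b : Fin n → K) (hb : b l = 1) (q : MvPolynomial (Fin n) K) :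
    aeval (Function.update b l 0) (aeval (Function.update (X : Fin n → MvPolynomial (Fin n) K) l 1) q) = aeval b q := by
  rw [← AlgHom.comp_apply, MvPolynomial.comp_aeval]
  have hfun : (fun i => aeval (Function.update b l 0) (Function.update (X : Fin n → MvPolynomial (Fin n) K) l 1 i)) = b := by
    funext j
    by_cases hj : j = l
    · subst hj
      rw [Function.update_self, map_one, hb]
    · rw [Function.update_of_ne hj, aeval_X, Function.update_of_ne hj]
  rw [hfun]

/-- **The strict transform is unique**: if `f(T_l, T_lT_j) = T_l^μ·G` and `= T_l^μ·G'` then `G = G'`. [folklore] -/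
theorem strictTransform_unique (l : Fin n) {μ : ℕ} {f G G' : MvPolynomial (Fin n) K}
    (hG : aeval (fun j => X l * Function.update (X : Fin n → MvPolynomial (Fin n) K) l 1 j) f = X l ^ μ * G)
    (hG' : aeval (fun j => X l * Function.update (X : Fin n → MvPolynomial (Fin n) K) l 1 j) f = X l ^ μ * G') : G = G' :=
  mul_left_cancel₀ (pow_ne_zero μ (X_ne_zero l)) (hG.symm.trans hG')

/-- ★ **(hone) ⇒ (FO): one-step points are first-order** (`K = K̄`).  `f = Φ + (Ψ₁ + Ψ')` as in ✓ `exists_strictTransform`; if for every chart `l`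
some (equivalently: the) strict transform `G_l` with `f(T_l, T_lT_j) = T_l^μ·G_l` passes the Jacobian criterion at every prime containing `T_l` and `G_l`,
then `Φ(b) = ∇Φ(b) = Ψ₁(b) = 0` only for `b = 0`.  Given such `b ≠ 0`, pick `l` with `b_l ≠ 0` and rescale to `b_l = 1` (all three conditions are
homogeneous); at the point `t = (b with b_l := 0)` of the exceptional divisor the kernel `P` of evaluation is a prime containing `T_l` and
`G_l = Φ(T̂) + T_l(Ψ₁(T̂) + T_lR)` (`G_l(t) = Φ(b) = 0`), and every `∂_jG_l` (`= ∂_jΦ(b)` or `Ψ₁(b)` at `t`), a contradiction.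
[cite: Hartshorne1977, I Thm. 5.1] -/
theorem forall_aeval_of_oneStep [IsAlgClosed K] (Φ Ψ₁ Ψ' : MvPolynomial (Fin n) K) {μ : ℕ} (hΦ : Φ.IsHomogeneous μ)
    (hΨ₁ : Ψ₁.IsHomogeneous (μ + 1)) (hΨ' : Ψ' ∈ Ideal.span (Set.range (X : Fin n → MvPolynomial (Fin n) K)) ^ (μ + 2))
    (hone : ∀ l : Fin n, ∃ G : MvPolynomial (Fin n) K,
      aeval (fun j => X l * Function.update (X : Fin n → MvPolynomial (Fin n) K) l 1 j) (Φ + (Ψ₁ + Ψ')) = X l ^ μ * G ∧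
      ∀ P : Ideal (MvPolynomial (Fin n) K), P.IsPrime → (X l : MvPolynomial (Fin n) K) ∈ P → G ∈ P → ∃ j, pderiv j G ∉ P)
    (b : Fin n → K) (h0 : aeval b Φ = 0) (hd : ∀ i, aeval b (pderiv i Φ) = 0) (hΨ : aeval b Ψ₁ = 0) : b = 0 := by
  classical
  by_contra hb
  obtain ⟨l, hl⟩ : ∃ l, b l ≠ 0 := by
    by_contra h
    push Not at h
    exact hb (funext h)
  -- rescale to `b_l = 1`
  set c : K := (b l)⁻¹ with hc
  set b' : Fin n → K := fun j => c * b j with hb'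
  have hb'l : b' l = 1 := by simp only [hb', hc]; exact inv_mul_cancel₀ hl
  have h0' : aeval b' Φ = 0 := by
    rw [hb', Cone.aeval_smul_eq_pow_mul_aeval hΦ c b, h0, mul_zero]
  have hd' : ∀ i, aeval b' (pderiv i Φ) = 0 := fun i => by
    rw [hb', Cone.aeval_smul_eq_pow_mul_aeval (hΦ.pderiv (i := i)) c b, hd i, mul_zero]
  have hΨ1' : aeval b' Ψ₁ = 0 := by
    rw [hb', Cone.aeval_smul_eq_pow_mul_aeval hΨ₁ c b, hΨ, mul_zero]
  -- the strict transform of chart `l`, in the first-order shape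
  set u : Fin n → MvPolynomial (Fin n) K := Function.update (X : Fin n → MvPolynomial (Fin n) K) l 1 with hu
  obtain ⟨R, hR⟩ := exists_aeval_subst_eq_pow_mul K l hΨ'
  have hG₀ : aeval (fun j => X l * Function.update (X : Fin n → MvPolynomial (Fin n) K) l 1 j) (Φ + (Ψ₁ + Ψ')) =
      X l ^ μ * (aeval u Φ + X l * (aeval u Ψ₁ + X l * R)) := by
    rw [map_add, map_add, aeval_subst_of_isHomogeneous K l hΦ, aeval_subst_of_isHomogeneous K l hΨ₁, hR]
    ring
  obtain ⟨G, hG, hjac⟩ := hone l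
  have hGeq : G = aeval u Φ + X l * (aeval u Ψ₁ + X l * R) := strictTransform_unique K l hG hG₀
  -- the point `t` of the exceptional divisor and the prime `P = ker (eval t)`
  set t : Fin n → K := Function.update b' l 0 with ht
  set P : Ideal (MvPolynomial (Fin n) K) := RingHom.ker (aeval t).toRingHom with hP
  haveI : P.IsPrime := RingHom.ker_isPrime _
  have hmem : ∀ q : MvPolynomial (Fin n) K, q ∈ P ↔ aeval t q = 0 := fun q => by rw [hP, RingHom.mem_ker]; rfl
  have htl : t l = 0 := by rw [ht, Function.update_self]
  have hXl : (X l : MvPolynomial (Fin n) K) ∈ P := by rw [hmem, aeval_X, htl]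
  have hev : ∀ q : MvPolynomial (Fin n) K, aeval t (aeval u q) = aeval b' q := fun q =>
    aeval_update_zero_aeval_update_one K l b' hb'l q
  have hGP : G ∈ P := by
    rw [hmem, hGeq, map_add, map_mul, aeval_X, htl, zero_mul, add_zero, hev, h0']
  obtain ⟨j, hj⟩ := hjac P inferInstance hXl hGP
  apply hj
  rw [hmem, hGeq]
  by_cases hjl : j = l
  · subst hjl
    rw [map_add, pderiv_aeval_update_self K j, zero_add, pderiv_mul, pderiv_X_self, one_mul, map_add, map_add, map_mul, map_mul,
      aeval_X, htl, zero_mul, zero_mul, add_zero, add_zero, hev, hΨ1']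
  · rw [map_add, pderiv_aeval_update_of_ne K hjl, pderiv_mul, pderiv_X_of_ne (Ne.symm hjl), zero_mul, zero_add, map_add, map_mul,
      aeval_X, htl, zero_mul, add_zero, hev, hd' j]

/-- ★ **FIRST-ORDER ⟺ ONE-STEP** (`K = K̄`): for `f = Φ + (Ψ₁ + Ψ')` (`Φ` a form of degree `μ`, `Ψ₁` of degree `μ + 1`, `Ψ' ∈ (y)^{μ+2}`), the
closed-point first-order criterion «`Φ(b) = ∇Φ(b) = Ψ₁(b) = 0` only for `b = 0`» is EQUIVALENT to T-ONESTEP's hypothesis «for every chart `l` an explicit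
strict transform with the Jacobian certificate at the primes containing `T_l`» (✓ `exists_strictTransform_of_forall_aeval`, `forall_aeval_of_oneStep`).
[cite: Hartshorne1977, I Thm. 5.1, II Ex. 7.12] -/
theorem firstOrder_iff_oneStep [IsAlgClosed K] (Φ Ψ₁ Ψ' : MvPolynomial (Fin n) K) {μ : ℕ} (hΦ : Φ.IsHomogeneous μ)
    (hΨ₁ : Ψ₁.IsHomogeneous (μ + 1)) (hΨ' : Ψ' ∈ Ideal.span (Set.range (X : Fin n → MvPolynomial (Fin n) K)) ^ (μ + 2)) :
    (∀ b : Fin n → K, aeval b Φ = 0 → (∀ i, aeval b (pderiv i Φ) = 0) → aeval b Ψ₁ = 0 → b = 0) ↔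
      ∀ l : Fin n, ∃ G : MvPolynomial (Fin n) K,
        aeval (fun j => X l * Function.update (X : Fin n → MvPolynomial (Fin n) K) l 1 j) (Φ + (Ψ₁ + Ψ')) = X l ^ μ * G ∧
        ∀ P : Ideal (MvPolynomial (Fin n) K), P.IsPrime → (X l : MvPolynomial (Fin n) K) ∈ P → G ∈ P → ∃ j, pderiv j G ∉ P :=
  ⟨fun h l => exists_strictTransform_of_forall_aeval K Φ Ψ₁ Ψ' hΦ hΨ₁ hΨ' h l, fun h => forall_aeval_of_oneStep K Φ Ψ₁ Ψ' hΦ hΨ₁ hΨ' h⟩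

end FirstOrderPoint

end Summit.ResolutionOfSingularities.ResolutionOfSingularities.Cruxes.EquisingularLiftNat.Sections

end
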